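import Summits.KontsevichZagierPeriods.Zeta5Search.Certificates.RecordRayLineProfile
import Mathlib.Analysis.SumIntegralComparisons
import Mathlib.Analysis.SpecialFunctions.Integrals.Basic
import HarnessLib

/-!
# ζ(5) search — certificates: the centre value of `|R_b(x+iY)|²` as Riemann sums of `log(u²+Y²)`
(cell `pub-zeta5`, certifier 2, generation 2)

HONEST FRAMING: systematic search; no irrationality claim unless certified.

OUR work (Summit side). The two-heights bound for `W(b)`, `U(b)` (`Certificates/RecordRayCoeffBound.lean`) is explicit in
the centre values `Mx = max(N(−h), N(−h−1/2))` of `N(x) = |R_b(x+iY)|² = Nm(x)/D(x)` (`RecordRayLineProfile`: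
`Nm(x) = 4q(x+h)∏_{i≤B₀} q(x+1+i)`, `D(x) = ∏_j∏_{i∈[B_j,B₀−B_j]} q(x+1+i)`, `q(u) = u²+Y²`). This file turns the two
products into RIEMANN SUMS of `g(u) = log(u²+Y²)` and bounds them by the antiderivative
`G(t) = t·log(t²+Y²) − 2t + 2Y·arctan(t/Y)` (`hasDerivAt_Gant`), using Mathlib's monotone sum–integral comparisons on the
two monotone halves of `g`:

* `sum_log_q_le` — `Σ_{i=0}^{N} g(i − c) ≤ g(c) + G(c) + G(N+1−c)` (`0 ≤ c ≤ N`);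
* `le_sum_log_q_window` — `G(c−B) + G(N−B−c) − 2G(1) ≤ Σ_{i=B}^{N−B} g(i − c)` (`B + 2 ≤ c ≤ N − B − 2`);
* `log_centre_le` — hence, for natural parameters `(B₀; B)` with `2B_j + 4 ≤ B₀`, `Y ≥ 1` and `c ∈ [B₀/2, B₀/2 + 1/2]`:
  `log(Nm(x₀)/D(x₀)) ≤ log 4 + g(1/2) + g(c) + 2G(B₀/2+1) − Σ_j (2G(B₀/2 − B_j − 1/2) − 2G(1))`, `x₀ = −1 − c`
  (both centre values `s = 0, −1/2` are `c = B₀/2 − s`).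

The ray-specific asymptotics (`Y = 3n`: `G_{3n}(τn) = 2τ·n log n + n·Γ₀(τ)`, `Γ₀(τ) = τlog(τ²+9) − 2τ + 6arctan(τ/3)`, and the
certified value `Γ₀(20.5) − Σ_jΓ₀(20.5−β_j) ≤ −47.67`) are the successor's step (CERTIFY-HOWTO §9 addendum 2).
-/

noncomputable section

open Finset Real Set MeasureTheory intervalIntegral

namespace Summit.KontsevichZagierPeriods.Zeta5Search.RecordLine

/-! ### `g` and its antiderivative `G` -/

/-- `g_Y(u) = log(u² + Y²)`. -/
def gl (Y u : ℝ) : ℝ := Real.log (u ^ 2 + Y ^ 2)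

/-- `G_Y(t) = t·log(t²+Y²) − 2t + 2Y·arctan(t/Y)`, an antiderivative of `g_Y`. -/
def Gant (Y t : ℝ) : ℝ := t * Real.log (t ^ 2 + Y ^ 2) - 2 * t + 2 * Y * Real.arctan (t / Y)

/-- `G_Y' = g_Y` (`Y ≠ 0`). -/
theorem hasDerivAt_Gant {Y : ℝ} (hY : Y ≠ 0) (t : ℝ) : HasDerivAt (Gant Y) (gl Y t) t := by
  have hq : t ^ 2 + Y ^ 2 ≠ 0 := by positivity
  have h1 : HasDerivAt (fun t : ℝ => t ^ 2 + Y ^ 2) (2 * t) t := by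
    simpa using (hasDerivAt_pow 2 t).add_const (Y ^ 2)
  have h2 : HasDerivAt (fun t : ℝ => Real.log (t ^ 2 + Y ^ 2)) (2 * t / (t ^ 2 + Y ^ 2)) t := by
    simpa using h1.log hq
  have h3 : HasDerivAt (fun t : ℝ => t * Real.log (t ^ 2 + Y ^ 2))
      (1 * Real.log (t ^ 2 + Y ^ 2) + t * (2 * t / (t ^ 2 + Y ^ 2))) t := (hasDerivAt_id t).mul h2
  have h4 : HasDerivAt (fun t : ℝ => Real.arctan (t / Y)) (1 / (1 + (t / Y) ^ 2) * (1 / Y)) t := by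
    have := (hasDerivAt_id t).div_const Y
    simpa using this.arctan
  have h5 := ((h3.sub ((hasDerivAt_id t).const_mul 2)).add (h4.const_mul (2 * Y)))
  have e : 1 * Real.log (t ^ 2 + Y ^ 2) + t * (2 * t / (t ^ 2 + Y ^ 2)) - 2 * 1 +
      2 * Y * (1 / (1 + (t / Y) ^ 2) * (1 / Y)) = gl Y t := by
    unfold gl
    field_simp
    ring
  rw [← e]
  refine h5.congr_of_eventuallyEq ?_
  exact Filter.Eventually.of_forall fun x => by simp [Gant]

/-- `g_Y` is continuous. -/
theorem continuous_gl (Y : ℝ) (hY : Y ≠ 0) : Continuous (gl Y) := by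
  unfold gl
  exact Continuous.log (by continuity) fun u => by positivity

/-- `∫_a^b g_Y = G_Y(b) − G_Y(a)`. -/
theorem integral_gl {Y : ℝ} (hY : Y ≠ 0) (a b : ℝ) : ∫ u in a..b, gl Y u = Gant Y b - Gant Y a :=
  integral_eq_sub_of_hasDerivAt (fun t _ => hasDerivAt_Gant hY t) ((continuous_gl Y hY).intervalIntegrable _ _)

/-- `g_Y` is even. -/
theorem gl_neg (Y u : ℝ) : gl Y (-u) = gl Y u := by unfold gl; ring_nf

/-- `g_Y` is monotone on `[0, ∞)`. -/
theorem gl_mono {Y u v : ℝ} (hu : 0 ≤ u) (huv : u ≤ v) (hY : Y ≠ 0) : gl Y u ≤ gl Y v := by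
  unfold gl
  apply Real.log_le_log (by positivity)
  nlinarith

/-- `g_Y ≥ 0` for `Y ≥ 1`. -/
theorem gl_nonneg {Y : ℝ} (hY : 1 ≤ Y) (u : ℝ) : 0 ≤ gl Y u := by
  unfold gl; apply Real.log_nonneg; nlinarith

/-- `G_Y` is odd. -/
theorem Gant_neg (Y t : ℝ) : Gant Y (-t) = -Gant Y t := by
  unfold Gant
  rw [neg_div, Real.arctan_neg]
  ring_nf

/-- `G_Y(0) = 0`. -/
theorem Gant_zero (Y : ℝ) : Gant Y 0 = 0 := by simp [Gant]

/-- `G_Y` is monotone for `Y ≥ 1` (its derivative `g_Y ≥ 0`). -/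
theorem Gant_mono {Y : ℝ} (hY : 1 ≤ Y) : Monotone (Gant Y) := by
  have hY0 : Y ≠ 0 := by intro h; rw [h] at hY; norm_num at hY
  refine monotone_of_deriv_nonneg (fun t => (hasDerivAt_Gant hY0 t).differentiableAt) fun t => ?_
  rw [(hasDerivAt_Gant hY0 t).deriv]
  exact gl_nonneg hY t

/-! ### Riemann sums of `g` against `G` -/

/-- `x ↦ g(x − c)` is antitone on `(−∞, c]` and monotone on `[c, ∞)`. -/
theorem gl_shift_antitoneOn {Y : ℝ} (hY : Y ≠ 0) (c : ℝ) {S : Set ℝ} (hS : ∀ x ∈ S, x ≤ c) :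
    AntitoneOn (fun x => gl Y (x - c)) S := by
  intro x hx y hy hxy
  have := gl_mono (Y := Y) (u := c - y) (v := c - x) (by linarith [hS y hy]) (by linarith) hY
  rw [show c - y = -(y - c) by ring, show c - x = -(x - c) by ring, gl_neg, gl_neg] at this
  exact this

/-- Monotone half. -/
theorem gl_shift_monotoneOn {Y : ℝ} (hY : Y ≠ 0) (c : ℝ) {S : Set ℝ} (hS : ∀ x ∈ S, c ≤ x) :
    MonotoneOn (fun x => gl Y (x - c)) S := by
  intro x hx y hy hxy
  exact gl_mono (by linarith [hS x hx]) (by linarith) hY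

/-- `∫_a^b g(x − c) dx = G(b − c) − G(a − c)`. -/
theorem integral_gl_shift {Y : ℝ} (hY : Y ≠ 0) (a b c : ℝ) :
    ∫ x in a..b, gl Y (x - c) = Gant Y (b - c) - Gant Y (a - c) := by
  rw [intervalIntegral.integral_comp_sub_right (fun x => gl Y x) c, integral_gl hY]

/-- **Upper Riemann bound for the full block**: for `Y ≥ 1`, `0 ≤ c ≤ N`,
`Σ_{i=0}^{N} g(i − c) ≤ g(c) + G(c) + G(N + 1 − c)`. -/
theorem sum_log_q_le {Y : ℝ} (hY : 1 ≤ Y) {c : ℝ} (hc : 0 ≤ c) {N : ℕ} (hcN : c ≤ N) :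
    ∑ i ∈ range (N + 1), gl Y ((i : ℝ) - c) ≤ gl Y c + Gant Y c + Gant Y ((N : ℝ) + 1 - c) := by
  have hY0 : Y ≠ 0 := by intro h; rw [h] at hY; norm_num at hY
  set i₀ := ⌊c⌋₊ with hi₀
  have hi₀c : (i₀ : ℝ) ≤ c := Nat.floor_le hc
  have hci₀ : c < (i₀ : ℝ) + 1 := Nat.lt_floor_add_one c
  have hi₀N : i₀ ≤ N := by
    have : (i₀ : ℝ) ≤ N := hi₀c.trans hcN
    exact_mod_cast this
  -- split the range at `i₀ + 1`
  rw [range_eq_Ico, ← sum_Ico_consecutive _ (Nat.zero_le (i₀ + 1)) (by omega : i₀ + 1 ≤ N + 1), ← range_eq_Ico,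
    sum_range_succ']
  -- part A: the term `i = 0` and the antitone part `i = 1..i₀`
  have hA : ∑ i ∈ range i₀, gl Y (((i + 1 : ℕ) : ℝ) - c) ≤ Gant Y c := by
    have hanti : AntitoneOn (fun x => gl Y (x - c)) (Icc (0 : ℝ) (0 + i₀)) :=
      gl_shift_antitoneOn hY0 c fun x hx => by linarith [hx.2]
    have h := AntitoneOn.sum_le_integral hanti
    simp only [zero_add] at h
    rw [integral_gl_shift hY0] at h
    have hG1 : Gant Y ((i₀ : ℝ) - c) ≤ 0 := by
      rw [← Gant_zero Y]; exact Gant_mono hY (by linarith)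
    have hG2 : Gant Y (0 - c) = -Gant Y c := by rw [zero_sub, Gant_neg]
    calc ∑ i ∈ range i₀, gl Y (((i + 1 : ℕ) : ℝ) - c) = ∑ i ∈ range i₀, gl Y ((((i + 1 : ℕ) : ℝ)) - c) := rfl
      _ ≤ Gant Y ((i₀ : ℝ) - c) - Gant Y (0 - c) := by simpa using h
      _ ≤ Gant Y c := by rw [hG2]; linarith
  have h0 : gl Y (((0 : ℕ) : ℝ) - c) = gl Y c := by rw [Nat.cast_zero, zero_sub, gl_neg]
  -- part B: the monotone part `i = i₀+1..N`
  have hB : ∑ i ∈ Finset.Ico (i₀ + 1) (N + 1), gl Y ((i : ℝ) - c) ≤ Gant Y ((N : ℝ) + 1 - c) := by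
    have hmono : MonotoneOn (fun x => gl Y (x - c)) (Icc ((i₀ + 1 : ℕ) : ℝ) ((N + 1 : ℕ) : ℝ)) :=
      gl_shift_monotoneOn hY0 c fun x hx => by have := hx.1; push_cast at this; linarith
    have h := MonotoneOn.sum_le_integral_Ico (by omega : i₀ + 1 ≤ N + 1) hmono
    rw [integral_gl_shift hY0] at h
    have hG1 : 0 ≤ Gant Y (((i₀ + 1 : ℕ) : ℝ) - c) := by
      rw [← Gant_zero Y]; exact Gant_mono hY (by push_cast; linarith)
    calc ∑ i ∈ Finset.Ico (i₀ + 1) (N + 1), gl Y ((i : ℝ) - c)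
        ≤ Gant Y (((N + 1 : ℕ) : ℝ) - c) - Gant Y (((i₀ + 1 : ℕ) : ℝ) - c) := h
      _ ≤ Gant Y ((N : ℝ) + 1 - c) := by push_cast at hG1 ⊢; linarith
  rw [h0]
  linarith

/-- **Lower Riemann bound for a window**: for `Y ≥ 1`, `B + 1 ≤ c`, `c + 2 ≤ N − B`:
`G(c − B) + G(N − B − c) − 2G(1) ≤ Σ_{i=B}^{N−B} g(i − c)`. -/
theorem le_sum_log_q_window {Y : ℝ} (hY : 1 ≤ Y) {c : ℝ} {B N : ℕ} (hBc : (B : ℝ) + 1 ≤ c)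
    (hcN : c + 2 ≤ (N : ℝ) - B) :
    Gant Y (c - B) + Gant Y ((N : ℝ) - B - c) - 2 * Gant Y 1 ≤
      ∑ i ∈ Finset.Ico B (N - B + 1), gl Y ((i : ℝ) - c) := by
  have hY0 : Y ≠ 0 := by intro h; rw [h] at hY; norm_num at hY
  have hc0 : 0 ≤ c := by have : (0:ℝ) ≤ B := Nat.cast_nonneg B; linarith
  set i₀ := ⌊c⌋₊ with hi₀
  have hi₀c : (i₀ : ℝ) ≤ c := Nat.floor_le hc0
  have hci₀ : c < (i₀ : ℝ) + 1 := Nat.lt_floor_add_one c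
  have hBN : B ≤ N := by
    have : (B : ℝ) ≤ N := by linarith
    exact_mod_cast this
  have hBi₀ : B ≤ i₀ := Nat.le_floor (by linarith)
  have hi₀top : i₀ + 2 ≤ N - B := by
    have h1 : ((i₀ : ℝ)) + 2 ≤ (N : ℝ) - B := by linarith
    have h2 : ((N - B : ℕ) : ℝ) = (N : ℝ) - B := Nat.cast_sub hBN
    have : ((i₀ + 2 : ℕ) : ℝ) ≤ ((N - B : ℕ) : ℝ) := by rw [h2]; push_cast; linarith
    exact_mod_cast this
  -- split `[B, N−B] = [B, i₀) ∪ [i₀, i₀+2) ∪ [i₀+2, N−B]`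
  have hsplit : ∑ i ∈ Finset.Ico B (N - B + 1), gl Y ((i : ℝ) - c) =
      ∑ i ∈ Finset.Ico B i₀, gl Y ((i : ℝ) - c) + ∑ i ∈ Finset.Ico i₀ (i₀ + 2), gl Y ((i : ℝ) - c) +
        ∑ i ∈ Finset.Ico (i₀ + 2) (N - B + 1), gl Y ((i : ℝ) - c) := by
    rw [sum_Ico_consecutive _ hBi₀ (by omega : i₀ ≤ i₀ + 2),
      sum_Ico_consecutive _ (by omega : B ≤ i₀ + 2) (by omega : i₀ + 2 ≤ N - B + 1)]
  have hmid : 0 ≤ ∑ i ∈ Finset.Ico i₀ (i₀ + 2), gl Y ((i : ℝ) - c) := sum_nonneg fun i _ => gl_nonneg hY _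
  -- left antitone part
  have hL : Gant Y (c - B) - Gant Y 1 ≤ ∑ i ∈ Finset.Ico B i₀, gl Y ((i : ℝ) - c) := by
    have hanti : AntitoneOn (fun x => gl Y (x - c)) (Icc (B : ℝ) (i₀ : ℝ)) :=
      gl_shift_antitoneOn hY0 c fun x hx => by linarith [hx.2]
    have h := AntitoneOn.integral_le_sum_Ico hBi₀ hanti
    rw [integral_gl_shift hY0] at h
    have hG1 : -Gant Y 1 ≤ Gant Y ((i₀ : ℝ) - c) := by
      rw [← Gant_neg]; exact Gant_mono hY (by linarith)
    have hG2 : Gant Y ((B : ℝ) - c) = -Gant Y (c - B) := by rw [← Gant_neg]; ring_nf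
    linarith
  -- right monotone part
  have hR : Gant Y ((N : ℝ) - B - c) - Gant Y 1 ≤ ∑ i ∈ Finset.Ico (i₀ + 2) (N - B + 1), gl Y ((i : ℝ) - c) := by
    have hmono : MonotoneOn (fun x => gl Y (x - c)) (Icc ((i₀ + 1 : ℕ) : ℝ) ((N - B : ℕ) : ℝ)) :=
      gl_shift_monotoneOn hY0 c fun x hx => by have := hx.1; push_cast at this; linarith
    have h := MonotoneOn.integral_le_sum_Ico (by omega : i₀ + 1 ≤ N - B) hmono
    rw [integral_gl_shift hY0] at h
    have hshift : ∑ i ∈ Finset.Ico (i₀ + 1) (N - B), gl Y (((i + 1 : ℕ) : ℝ) - c) =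
        ∑ i ∈ Finset.Ico (i₀ + 2) (N - B + 1), gl Y ((i : ℝ) - c) := by
      rw [← sum_Ico_add' (fun i : ℕ => gl Y ((i : ℝ) - c)) (i₀ + 1) (N - B) 1]
    have hG1 : Gant Y (((i₀ + 1 : ℕ) : ℝ) - c) ≤ Gant Y 1 := Gant_mono hY (by push_cast; linarith)
    have hG2 : Gant Y (((N - B : ℕ) : ℝ) - c) = Gant Y ((N : ℝ) - B - c) := by rw [Nat.cast_sub hBN]
    rw [hshift, hG2] at h
    linarith
  rw [hsplit]
  linarith

/-! ### The centre value -/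

open Summit.KontsevichZagierPeriods.Zeta5Search.DualSeriesBounds (natB)

/-- `log q = g`. -/
theorem log_qsq (Y u : ℝ) : Real.log (qsq Y u) = gl Y u := rfl

/-- **THE CENTRE VALUE AS RIEMANN SUMS.** For natural parameters with `2B_j + 5 ≤ B₀`, `Y ≥ 1` and
`B₀/2 ≤ c ≤ B₀/2 + 1/2` (the two centre points are `x₀ = −1 − c`, `c = B₀/2` and `c = B₀/2 + 1/2`):
`log(Nm(x₀)/D(x₀)) ≤ log 4 + g(1/2) + g(c) + G(c) + G(B₀+1−c) − Σ_j (G(c−B_j) + G(B₀−B_j−c) − 2G(1))`. -/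
theorem log_centre_le (B₀ : ℕ) (B : ℕ → ℕ) (hB : ∀ j ∈ range 7, 2 * B j + 5 ≤ B₀) {Y : ℝ} (hY : 1 ≤ Y)
    {c : ℝ} (hc1 : (B₀ : ℝ) / 2 ≤ c) (hc2 : c ≤ (B₀ : ℝ) / 2 + 1 / 2) :
    Real.log (Nm B₀ Y (-1 - c) / Dx B₀ B Y (-1 - c)) ≤
      Real.log 4 + gl Y (1 / 2) + gl Y c + Gant Y c + Gant Y ((B₀ : ℝ) + 1 - c) -
        ∑ j ∈ range 7, (Gant Y (c - B j) + Gant Y ((B₀ : ℝ) - B j - c) - 2 * Gant Y 1) := by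
  have hY0 : Y ≠ 0 := by intro h; rw [h] at hY; norm_num at hY
  have hYpos : 0 < Y := by linarith
  have hNm := Nm_pos B₀ hYpos (-1 - c)
  have hDx := Dx_pos B₀ B hYpos (-1 - c)
  rw [Real.log_div hNm.ne' hDx.ne']
  -- the numerator
  have hN : Real.log (Nm B₀ Y (-1 - c)) ≤ Real.log 4 + gl Y (1 / 2) + (gl Y c + Gant Y c + Gant Y ((B₀ : ℝ) + 1 - c)) := by
    unfold Nm
    rw [Real.log_mul (by unfold qsq; positivity) (prod_pos fun _ _ => by unfold qsq; positivity).ne',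
      Real.log_mul (by norm_num) (by unfold qsq; positivity), Real.log_prod (fun i _ => by unfold qsq; positivity)]
    have h1 : Real.log (qsq Y (-1 - c + ((B₀ : ℝ) + 2) / 2)) ≤ gl Y (1 / 2) := by
      rw [log_qsq]
      have e : -1 - c + ((B₀ : ℝ) + 2) / 2 = (B₀ : ℝ) / 2 - c := by ring
      rw [e]
      rcases le_or_gt 0 ((B₀ : ℝ) / 2 - c) with h | h
      · exact gl_mono h (by linarith) hY0
      · rw [← gl_neg]; exact gl_mono (by linarith) (by linarith) hY0
    have hB0 : (5 : ℝ) ≤ B₀ := by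
      have := hB 0 (by simp)
      exact_mod_cast (show 5 ≤ B₀ by omega)
    have h2 : ∑ i ∈ range (B₀ + 1), Real.log (qsq Y (-1 - c + 1 + (i : ℝ))) ≤
        gl Y c + Gant Y c + Gant Y ((B₀ : ℝ) + 1 - c) := by
      have := sum_log_q_le hY (c := c) (by linarith) (N := B₀) (by linarith)
      refine le_trans (le_of_eq (sum_congr rfl fun i _ => ?_)) this
      rw [log_qsq]; ring_nf
    linarith
  -- the denominator
  have hD : ∑ j ∈ range 7, (Gant Y (c - B j) + Gant Y ((B₀ : ℝ) - B j - c) - 2 * Gant Y 1) ≤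
      Real.log (Dx B₀ B Y (-1 - c)) := by
    unfold Dx
    rw [Real.log_prod (fun j _ => (prod_pos fun _ _ => by unfold qsq; positivity).ne')]
    refine sum_le_sum fun j hj => ?_
    have hBj := hB j hj
    rw [Real.log_prod (fun i _ => by unfold qsq; positivity)]
    have hBjR : 2 * (B j : ℝ) + 5 ≤ B₀ := by exact_mod_cast hBj
    have := le_sum_log_q_window hY (c := c) (B := B j) (N := B₀) (by linarith) (by linarith)
    rw [show B₀ - B j + 1 = B₀ + 1 - B j by omega] at this
    refine le_trans this (le_of_eq (sum_congr rfl fun i _ => ?_))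
    rw [log_qsq]; ring_nf
  linarith

end Summit.KontsevichZagierPeriods.Zeta5Search.RecordLine
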